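import Literature.NumberTheory.Sieve.IwaniecAlmostPrimesPairBound
import Literature.NumberTheory.Sieve.IwaniecAlmostPrimesProp1Corollary
import Literature.NumberTheory.Sieve.DivisorBound
import HarnessLib

/-!
# Iwaniec (1978), §4: the size of the dispersion summand of one pair — PROVED

H. Iwaniec, *Almost-primes represented by quadratic polynomials*, Invent. Math. 47 (1978)
171–188, §4 pp. 184–185.

With the parameters of the proof of Proposition 1 (`A' = ⌊M⌋`, `B₀ = ⌈2M⌉ − 1`, `E = ⌊M^{1/3}⌋`,
`G = ⌊√B₀⌋`, Lemma 4 with exponent `η`) the bound `|T(n₁,n₂)| ≤ |κ| pairRes + pairErr` of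
`IwaniecAlmostPrimesPairBound` is made crude and uniform (`abs_tsum2_le_crude`): for squarefree
`n₁, n₂ < K`, `2 ≤ M ≤ x`,
`|T(n₁, n₂)| ≤ C J³ (1 + log 16x)² (x (n₁,n₂)/(n₁ n₂) + x² M^{−5/4+η/2} K^{3/2+η} (n₁,n₂))`,
`J = C_η K^{4η}` bounding every `ρ` and `τ` that occurs (`ρ ≤ τ ≤ C_η n^η`, `DivisorBound`),
`∑_{m ≤ y} ρ(m) ≤ C_ρ y` (`exists_sum_rho_le`).  The first term is the residual of the main-term
cancellation, the second the errors of Lemma 4 (p. 184, the term `x^{…} N^{7/2} M^{−5/4}` after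
summing `(n₁, n₂)` over the pairs).
-/

noncomputable section

open Finset Real

namespace Literature.NumberTheory.Sieve.Iwaniec1978

/-! ### The parameters `A' = ⌊M⌋`, `B₀ = ⌈2M⌉ − 1`, `E = ⌊M^{1/3}⌋` -/

/-- Integer facts about the parameters for `M ≥ 2`. [folklore] -/
theorem params_nat {M : ℝ} (hM : 2 ≤ M) :
    2 ≤ ⌊M⌋₊ ∧ ⌊M⌋₊ ≤ ⌈2 * M⌉₊ - 1 ∧ 1 ≤ ⌊M ^ (1 / 3 : ℝ)⌋₊ ∧ ⌊M ^ (1 / 3 : ℝ)⌋₊ ≤ ⌊M⌋₊ := by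
  have hM0 : 0 ≤ M := by linarith
  have hM1 : 1 ≤ M := by linarith
  refine ⟨Nat.le_floor (by norm_num; linarith), ?_, ?_, ?_⟩
  · have : ⌊M⌋₊ < ⌈2 * M⌉₊ := by
      have h1 : (⌊M⌋₊ : ℝ) ≤ M := Nat.floor_le hM0
      have h2 : (⌊M⌋₊ : ℝ) < 2 * M := by linarith
      exact Nat.lt_ceil.mpr h2
    omega
  · exact Nat.le_floor (by rw [Nat.cast_one]; exact Real.one_le_rpow hM1 (by norm_num))
  · refine Nat.floor_le_floor ?_
    calc M ^ (1 / 3 : ℝ) ≤ M ^ (1 : ℝ) := Real.rpow_le_rpow_of_exponent_le hM1 (by norm_num)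
      _ = M := Real.rpow_one M

/-- Real facts about the parameters for `M ≥ 2`. [folklore] -/
theorem params_real {M : ℝ} (hM : 2 ≤ M) :
    (⌊M⌋₊ : ℝ) ≤ M ∧ M < ⌊M⌋₊ + 1 ∧ M / 2 ≤ ⌊M⌋₊ ∧ (((⌈2 * M⌉₊ - 1 : ℕ)) : ℝ) ≤ 2 * M ∧
      (((⌈2 * M⌉₊ - 1 - ⌊M⌋₊ : ℕ)) : ℝ) ≤ 2 * M ∧ (⌊M ^ (1 / 3 : ℝ)⌋₊ : ℝ) ≤ M ^ (1 / 3 : ℝ) ∧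
      M ^ (1 / 3 : ℝ) / 2 ≤ ⌊M ^ (1 / 3 : ℝ)⌋₊ ∧ (2 : ℝ) ≤ ((⌈2 * M⌉₊ - 1 : ℕ) : ℝ) := by
  have hM0 : 0 ≤ M := by linarith
  have hM1 : 1 ≤ M := by linarith
  obtain ⟨hA2, hAB, hE1, -⟩ := params_nat hM
  have h1 : (⌊M⌋₊ : ℝ) ≤ M := Nat.floor_le hM0
  have h2 : M < ⌊M⌋₊ + 1 := Nat.lt_floor_add_one M
  have hc : ((⌈2 * M⌉₊ - 1 : ℕ) : ℝ) = ⌈2 * M⌉₊ - 1 := by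
    have : 1 ≤ ⌈2 * M⌉₊ := by omega
    rw [Nat.cast_sub this, Nat.cast_one]
  have hc2 : (⌈2 * M⌉₊ : ℝ) < 2 * M + 1 := Nat.ceil_lt_add_one (by linarith)
  have hy0 : 0 ≤ M ^ (1 / 3 : ℝ) := Real.rpow_nonneg hM0 _
  have hE : (⌊M ^ (1 / 3 : ℝ)⌋₊ : ℝ) ≤ M ^ (1 / 3 : ℝ) := Nat.floor_le hy0
  have hE' : M ^ (1 / 3 : ℝ) < ⌊M ^ (1 / 3 : ℝ)⌋₊ + 1 := Nat.lt_floor_add_one _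
  have hE1' : (1 : ℝ) ≤ ⌊M ^ (1 / 3 : ℝ)⌋₊ := by exact_mod_cast hE1
  refine ⟨h1, h2, by linarith, by rw [hc]; linarith, ?_, hE, by linarith, ?_⟩
  · rw [Nat.cast_sub hAB, hc]; linarith
  · have : ((2 : ℕ) : ℝ) ≤ ((⌈2 * M⌉₊ - 1 : ℕ) : ℝ) := by exact_mod_cast hA2.trans hAB
    simpa using this

/-- `⌊⌊x⌋/(A'+1)⌋ + 1 ≤ 2x/M` for `M ≤ x`, `M < A' + 1`. [folklore] -/
theorem lfac_le {x M : ℝ} {A' : ℕ} (hM : 0 < M) (hMx : M ≤ x) (hA : M < A' + 1) :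
    (((⌊x⌋₊ / (A' + 1) + 1 : ℕ)) : ℝ) ≤ 2 * x / M := by
  have hx0 : 0 ≤ x := hM.le.trans hMx
  have hA0 : (0 : ℝ) < A' + 1 := by positivity
  push_cast
  have h1 : (((⌊x⌋₊ / (A' + 1) : ℕ)) : ℝ) ≤ x / (A' + 1) := by
    calc (((⌊x⌋₊ / (A' + 1) : ℕ)) : ℝ) ≤ (⌊x⌋₊ : ℝ) / ((A' + 1 : ℕ) : ℝ) := Nat.cast_div_le
      _ = (⌊x⌋₊ : ℝ) / (A' + 1) := by push_cast; ring
      _ ≤ x / (A' + 1) := div_le_div_of_nonneg_right (Nat.floor_le hx0) hA0.le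
  have h2 : x / (A' + 1) ≤ x / M := div_le_div_of_nonneg_left hx0 hM hA.le
  have h3 : 1 ≤ x / M := by rw [le_div_iff₀ hM]; linarith
  calc (((⌊x⌋₊ / (A' + 1) : ℕ)) : ℝ) + 1 ≤ x / M + x / M := by linarith
    _ = 2 * x / M := by ring

/-- `√B₀ √E + B₀/E ≤ 6 M^{2/3}` for `B₀ ≤ 2M`, `M^{1/3}/2 ≤ E ≤ M^{1/3}`, `M ≥ 1`. [folklore] -/
theorem eterm_le {M : ℝ} {B₀ E : ℕ} (hM : 1 ≤ M) (hB : (B₀ : ℝ) ≤ 2 * M)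
    (hE : (E : ℝ) ≤ M ^ (1 / 3 : ℝ)) (hE' : M ^ (1 / 3 : ℝ) / 2 ≤ E) (hE1 : 1 ≤ E) :
    Real.sqrt B₀ * Real.sqrt E + B₀ / E ≤ 6 * M ^ (2 / 3 : ℝ) := by
  have hM0 : 0 < M := by linarith
  have hE0 : (0 : ℝ) < E := by exact_mod_cast hE1
  have h13 : 0 < M ^ (1 / 3 : ℝ) := Real.rpow_pos_of_pos hM0 _
  have hpow : M ^ (2 / 3 : ℝ) = Real.sqrt M * M ^ (1 / 6 : ℝ) := by
    rw [Real.sqrt_eq_rpow, ← Real.rpow_add hM0]; norm_num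
  have hpow' : M ^ (2 / 3 : ℝ) = M / M ^ (1 / 3 : ℝ) := by
    rw [show (2 / 3 : ℝ) = 1 - 1 / 3 by norm_num, Real.rpow_sub hM0, Real.rpow_one]
  have h1 : Real.sqrt B₀ ≤ Real.sqrt 2 * Real.sqrt M := by
    rw [← Real.sqrt_mul (by norm_num)]; exact Real.sqrt_le_sqrt hB
  have h2 : Real.sqrt E ≤ M ^ (1 / 6 : ℝ) := by
    calc Real.sqrt E ≤ Real.sqrt (M ^ (1 / 3 : ℝ)) := Real.sqrt_le_sqrt hE
      _ = M ^ (1 / 6 : ℝ) := by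
          rw [Real.sqrt_eq_rpow, ← Real.rpow_mul hM0.le]; norm_num
  have h3 : (B₀ : ℝ) / E ≤ 2 * M / (M ^ (1 / 3 : ℝ) / 2) :=
    div_le_div₀ (by positivity) hB (by positivity) hE'
  have h13' : M ^ (1 / 3 : ℝ) ≠ 0 := h13.ne'
  have hs2 : Real.sqrt 2 ≤ 2 := by
    rw [show (2 : ℝ) = Real.sqrt 4 by rw [show (4 : ℝ) = 2 ^ 2 by norm_num, Real.sqrt_sq (by norm_num)]]
    exact Real.sqrt_le_sqrt (by norm_num)
  have h23 : 0 ≤ M ^ (2 / 3 : ℝ) := Real.rpow_nonneg hM0.le _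
  calc Real.sqrt B₀ * Real.sqrt E + B₀ / E
      ≤ Real.sqrt 2 * Real.sqrt M * M ^ (1 / 6 : ℝ) + 2 * M / (M ^ (1 / 3 : ℝ) / 2) :=
        add_le_add (mul_le_mul h1 h2 (Real.sqrt_nonneg _) (by positivity)) h3
    _ = Real.sqrt 2 * M ^ (2 / 3 : ℝ) + 4 * M ^ (2 / 3 : ℝ) := by
        rw [mul_assoc, ← hpow, hpow']; field_simp; ring
    _ ≤ 2 * M ^ (2 / 3 : ℝ) + 4 * M ^ (2 / 3 : ℝ) := by
        have := mul_le_mul_of_nonneg_right hs2 h23; linarith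
    _ = 6 * M ^ (2 / 3 : ℝ) := by ring

/-- The `S`-factor of Lemma 4: `⌊√(t k)⌋^{1/2+η} ⌊√(t k)⌋ ≤ 2 M^{3/4+η/2} K^{3/2+η}` for
`t ≤ 2M`, `k ≤ K²`, `0 ≤ η ≤ 1/2`. [folklore] -/
theorem sfac_le {M K η : ℝ} {t k : ℕ} (hM : 1 ≤ M) (hK : 1 ≤ K) (hη : 0 ≤ η) (hη2 : η ≤ 1 / 2)
    (ht : (t : ℝ) ≤ 2 * M) (hk : (k : ℝ) ≤ K ^ 2) :
    (Nat.sqrt (t * k) : ℝ) ^ (1 / 2 + η) * Nat.sqrt (t * k) ≤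
      2 * M ^ (3 / 4 + η / 2 : ℝ) * K ^ (3 / 2 + η : ℝ) := by
  have hM0 : 0 < M := by linarith
  have hK0 : 0 < K := by linarith
  set Y : ℝ := Real.sqrt (2 * M) * K with hY
  have hY0 : 0 < Y := by positivity
  have hS0 : (0 : ℝ) ≤ Nat.sqrt (t * k) := Nat.cast_nonneg _
  have hS : (Nat.sqrt (t * k) : ℝ) ≤ Y := by
    calc (Nat.sqrt (t * k) : ℝ) ≤ Real.sqrt ((t * k : ℕ) : ℝ) := Real.nat_sqrt_le_real_sqrt
      _ ≤ Real.sqrt (2 * M * K ^ 2) := by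
          apply Real.sqrt_le_sqrt
          push_cast
          exact mul_le_mul ht hk (Nat.cast_nonneg _) (by linarith)
      _ = Y := by
          rw [hY, Real.sqrt_mul (by linarith), Real.sqrt_sq hK0.le]
  have h1 : (Nat.sqrt (t * k) : ℝ) ^ (1 / 2 + η) ≤ Y ^ (1 / 2 + η) :=
    Real.rpow_le_rpow hS0 hS (by linarith)
  have h2 : (Nat.sqrt (t * k) : ℝ) ^ (1 / 2 + η) * Nat.sqrt (t * k) ≤ Y ^ (1 / 2 + η) * Y :=
    mul_le_mul h1 hS hS0 (Real.rpow_nonneg hY0.le _)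
  have h3 : Y ^ (1 / 2 + η) * Y = Y ^ (3 / 2 + η : ℝ) := by
    rw [← Real.rpow_add_one hY0.ne']; norm_num; ring_nf
  have h4 : Y ^ (3 / 2 + η : ℝ) = (2 : ℝ) ^ (3 / 4 + η / 2 : ℝ) * M ^ (3 / 4 + η / 2 : ℝ) *
      K ^ (3 / 2 + η : ℝ) := by
    rw [hY, Real.mul_rpow (Real.sqrt_nonneg _) hK0.le, Real.sqrt_eq_rpow,
      ← Real.rpow_mul (by linarith), Real.mul_rpow (by norm_num) hM0.le]
    congr 2 <;> ring_nf
  have h5 : (2 : ℝ) ^ (3 / 4 + η / 2 : ℝ) ≤ 2 := by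
    calc (2 : ℝ) ^ (3 / 4 + η / 2 : ℝ) ≤ (2 : ℝ) ^ (1 : ℝ) :=
          Real.rpow_le_rpow_of_exponent_le (by norm_num) (by linarith)
      _ = 2 := Real.rpow_one 2
  have hMK : 0 ≤ M ^ (3 / 4 + η / 2 : ℝ) * K ^ (3 / 2 + η : ℝ) := by positivity
  calc (Nat.sqrt (t * k) : ℝ) ^ (1 / 2 + η) * Nat.sqrt (t * k) ≤ Y ^ (3 / 2 + η : ℝ) := by
        rw [← h3]; exact h2
    _ = (2 : ℝ) ^ (3 / 4 + η / 2 : ℝ) * (M ^ (3 / 4 + η / 2 : ℝ) * K ^ (3 / 2 + η : ℝ)) := by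
        rw [h4]; ring
    _ ≤ 2 * (M ^ (3 / 4 + η / 2 : ℝ) * K ^ (3 / 2 + η : ℝ)) := mul_le_mul_of_nonneg_right h5 hMK
    _ = _ := by ring

/-- `M^{1/4}/2 ≤ A'^{1/4}` for `M/2 ≤ A'`. [folklore] -/
theorem quarter_le {M : ℝ} {A' : ℕ} (hM : 0 ≤ M) (hA : M / 2 ≤ A') :
    M ^ (1 / 4 : ℝ) / 2 ≤ (A' : ℝ) ^ (1 / 4 : ℝ) := by
  have h1 : (M / 2) ^ (1 / 4 : ℝ) ≤ (A' : ℝ) ^ (1 / 4 : ℝ) :=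
    Real.rpow_le_rpow (by positivity) hA (by norm_num)
  have h2 : (M / 2) ^ (1 / 4 : ℝ) = M ^ (1 / 4 : ℝ) / (2 : ℝ) ^ (1 / 4 : ℝ) :=
    Real.div_rpow hM (by norm_num) _
  have h3 : (2 : ℝ) ^ (1 / 4 : ℝ) ≤ 2 := by
    calc (2 : ℝ) ^ (1 / 4 : ℝ) ≤ (2 : ℝ) ^ (1 : ℝ) :=
          Real.rpow_le_rpow_of_exponent_le (by norm_num) (by norm_num)
      _ = 2 := Real.rpow_one 2
  have h4 : 0 < (2 : ℝ) ^ (1 / 4 : ℝ) := by positivity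
  have hM4 : 0 ≤ M ^ (1 / 4 : ℝ) := Real.rpow_nonneg hM _
  calc M ^ (1 / 4 : ℝ) / 2 ≤ M ^ (1 / 4 : ℝ) / (2 : ℝ) ^ (1 / 4 : ℝ) :=
        div_le_div_of_nonneg_left hM4 h4 h3
    _ ≤ _ := by rw [← h2]; exact h1

/-- The first term of the Lemma-4 error: `4 ρ Σ / A'^{1/4} ≤ 16 C_ρ J M^{3/4}`. [folklore] -/
theorem firstTerm_le {ρ₀ S0 A4 J Cρ M : ℝ} (hM : 0 < M) (hρ : ρ₀ ≤ J) (hρ0 : 0 ≤ ρ₀) (hS0le : S0 ≤ 2 * Cρ * M)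
    (hS00 : 0 ≤ S0) (hCρ : 0 ≤ Cρ) (hA : M ^ (1 / 4 : ℝ) / 2 ≤ A4) :
    4 * ρ₀ * S0 / A4 ≤ 16 * Cρ * J * M ^ (3 / 4 : ℝ) := by
  have hM4 : 0 < M ^ (1 / 4 : ℝ) := Real.rpow_pos_of_pos hM _
  have hA0 : 0 < A4 := lt_of_lt_of_le (by positivity) hA
  have hJ : 0 ≤ J := hρ0.trans hρ
  have hnum : 4 * ρ₀ * S0 ≤ 4 * J * (2 * Cρ * M) :=
    mul_le_mul (mul_le_mul_of_nonneg_left hρ (by norm_num)) hS0le hS00 (by positivity)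
  have hpow : M / M ^ (1 / 4 : ℝ) = M ^ (3 / 4 : ℝ) := by
    rw [show (3 / 4 : ℝ) = 1 - 1 / 4 by norm_num, Real.rpow_sub hM, Real.rpow_one]
  calc 4 * ρ₀ * S0 / A4 ≤ 4 * J * (2 * Cρ * M) / A4 := div_le_div_of_nonneg_right hnum hA0.le
    _ ≤ 4 * J * (2 * Cρ * M) / (M ^ (1 / 4 : ℝ) / 2) :=
        div_le_div_of_nonneg_left (by positivity) (by positivity) hA
    _ = 16 * Cρ * J * (M / M ^ (1 / 4 : ℝ)) := by field_simp; ring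
    _ = _ := by rw [hpow]

/-! ### Crude forms of the two Lemma-4 errors -/

/-- `wErr ≤ (16 C_ρ + C_W + 108) d J² Lg P` under the crude bounds of its ingredients. [folklore] -/
theorem wErr_le_crude {CW η Cρ J M P Lg : ℝ} {q d A' B₀ E : ℕ} (hCW : 0 ≤ CW) (hCρ : 0 ≤ Cρ)
    (hJ1 : 1 ≤ J) (hM : 0 < M) (hLg1 : 1 ≤ Lg) (hq1 : 1 ≤ q) (hd1 : 1 ≤ d)
    (hρq : (rho q : ℝ) ≤ J) (hSum0 : (rhoSumAP B₀ q 1 0 : ℝ) ≤ 2 * Cρ * M)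
    (hA : M ^ (1 / 4 : ℝ) / 2 ≤ (A' : ℝ) ^ (1 / 4 : ℝ))
    (hsum : ∑ l ∈ q.divisors, (rho (l * q) : ℝ) ≤ J ^ 2)
    (hlog : (1 + Real.log (16 * A')) ^ 2 ≤ Lg)
    (hS : (Nat.sqrt (B₀ * q) : ℝ) ^ (1 / 2 + η) * Nat.sqrt (B₀ * q) ≤ P)
    (hP34 : M ^ (3 / 4 : ℝ) ≤ P) (hP23 : M ^ (2 / 3 : ℝ) ≤ P)
    (hτ : 2 * (q.divisors.card : ℝ) + 7 ≤ 9 * J)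
    (hEt : Real.sqrt B₀ * Real.sqrt E + B₀ / E ≤ 6 * M ^ (2 / 3 : ℝ)) :
    wErr CW η q d A' B₀ E ≤ (16 * Cρ + CW + 108) * d * J ^ 2 * Lg * P := by
  have hJ0 : 0 ≤ J := by linarith
  have hP0 : 0 ≤ P := (Real.rpow_nonneg hM.le _).trans hP34
  have hd0 : (1 : ℝ) ≤ d := by exact_mod_cast hd1
  have h1 : 4 * (rho q : ℝ) * (rhoSumAP B₀ q 1 0 : ℝ) / (A' : ℝ) ^ (1 / 4 : ℝ) ≤
      16 * Cρ * J * M ^ (3 / 4 : ℝ) :=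
    firstTerm_le hM hρq (Nat.cast_nonneg _) hSum0 (Nat.cast_nonneg _) hCρ hA
  have h1' : 16 * Cρ * J * M ^ (3 / 4 : ℝ) ≤ 16 * Cρ * (d * J ^ 2 * Lg * P) := by
    rw [mul_assoc (16 * Cρ)]
    apply mul_le_mul_of_nonneg_left _ (by positivity)
    calc J * M ^ (3 / 4 : ℝ) = 1 * (J * 1) * 1 * M ^ (3 / 4 : ℝ) := by ring
      _ ≤ d * (J * J) * Lg * P := by
          apply mul_le_mul _ hP34 (Real.rpow_nonneg hM.le _) (by positivity)
          apply mul_le_mul _ hLg1 zero_le_one (by positivity)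
          exact mul_le_mul hd0 (mul_le_mul_of_nonneg_left hJ1 hJ0) (by positivity) (by positivity)
      _ = d * J ^ 2 * Lg * P := by ring
  have h2 : CW * d * (∑ l ∈ q.divisors, (rho (l * q) : ℝ)) * (1 + Real.log (16 * A')) ^ 2 *
      ((Nat.sqrt (B₀ * q) : ℝ) ^ (1 / 2 + η) * Nat.sqrt (B₀ * q)) ≤ CW * (d * J ^ 2 * Lg * P) := by
    have hS0 : 0 ≤ (Nat.sqrt (B₀ * q) : ℝ) ^ (1 / 2 + η) * Nat.sqrt (B₀ * q) :=
      mul_nonneg (Real.rpow_nonneg (Nat.cast_nonneg _) _) (Nat.cast_nonneg _)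
    calc CW * d * (∑ l ∈ q.divisors, (rho (l * q) : ℝ)) * (1 + Real.log (16 * A')) ^ 2 *
          ((Nat.sqrt (B₀ * q) : ℝ) ^ (1 / 2 + η) * Nat.sqrt (B₀ * q))
        = CW * (d * ((∑ l ∈ q.divisors, (rho (l * q) : ℝ)) * ((1 + Real.log (16 * A')) ^ 2 *
          ((Nat.sqrt (B₀ * q) : ℝ) ^ (1 / 2 + η) * Nat.sqrt (B₀ * q))))) := by ring
      _ ≤ CW * (d * (J ^ 2 * (Lg * P))) := by
          apply mul_le_mul_of_nonneg_left _ hCW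
          apply mul_le_mul_of_nonneg_left _ (by positivity)
          exact mul_le_mul hsum (mul_le_mul hlog hS hS0 (by positivity)) (by positivity)
            (by positivity)
      _ = CW * (d * J ^ 2 * Lg * P) := by ring
  have h3 : 2 / q * (rho q : ℝ) * ((2 * q.divisors.card + 7) * (Real.sqrt B₀ * Real.sqrt E + B₀ / E)) ≤
      108 * (d * J ^ 2 * Lg * P) := by
    have hq0 : (1 : ℝ) ≤ q := by exact_mod_cast hq1
    have h2q : 2 / (q : ℝ) ≤ 2 := by
      rw [div_le_iff₀ (by positivity)]; nlinarith
    have hEt0 : 0 ≤ Real.sqrt B₀ * Real.sqrt E + B₀ / E := by positivity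
    calc 2 / q * (rho q : ℝ) * ((2 * q.divisors.card + 7) * (Real.sqrt B₀ * Real.sqrt E + B₀ / E))
        ≤ 2 * J * (9 * J * (6 * M ^ (2 / 3 : ℝ))) :=
          mul_le_mul (mul_le_mul h2q hρq (Nat.cast_nonneg _) (by norm_num))
            (mul_le_mul hτ hEt hEt0 (by positivity)) (by positivity) (by positivity)
      _ = 108 * (1 * (J * J) * 1 * M ^ (2 / 3 : ℝ)) := by ring
      _ ≤ 108 * (d * (J * J) * Lg * P) := by
          apply mul_le_mul_of_nonneg_left _ (by norm_num)
          apply mul_le_mul _ hP23 (Real.rpow_nonneg hM.le _) (by positivity)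
          apply mul_le_mul _ hLg1 zero_le_one (by positivity)
          exact mul_le_mul_of_nonneg_right hd0 (by positivity)
      _ = 108 * (d * J ^ 2 * Lg * P) := by ring
  unfold wErr
  have : (16 * Cρ + CW + 108) * d * J ^ 2 * Lg * P =
      16 * Cρ * (d * J ^ 2 * Lg * P) + CW * (d * J ^ 2 * Lg * P) + 108 * (d * J ^ 2 * Lg * P) := by
    ring
  rw [this]
  exact add_le_add (add_le_add (h1.trans h1') h2) h3

/-- `windowErr(n; q, 1, 0) ≤ (16 C_ρ + C_V + 108) J² Lg P` under the crude bounds of its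
ingredients. [folklore] -/
theorem windowErr_le_crude {CV η Cρ J M P Lg : ℝ} {n q A' B₀ E : ℕ} (hCV : 0 ≤ CV) (hCρ : 0 ≤ Cρ)
    (hJ1 : 1 ≤ J) (hM : 0 < M) (hLg1 : 1 ≤ Lg) (hn1 : 1 ≤ n)
    (hρn : (rho n : ℝ) ≤ J) (hSum0 : (rhoSumAP B₀ q 1 0 : ℝ) ≤ 2 * Cρ * M)
    (hA : M ^ (1 / 4 : ℝ) / 2 ≤ (A' : ℝ) ^ (1 / 4 : ℝ))
    (hsum : ∑ l ∈ q.divisors, (rho (l * n) : ℝ) ≤ J ^ 2)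
    (hlog : (1 + Real.log (16 * A')) ^ 2 ≤ Lg)
    (hS : (Nat.sqrt (B₀ * n) : ℝ) ^ (1 / 2 + η) * Nat.sqrt (B₀ * n) ≤ P)
    (hP34 : M ^ (3 / 4 : ℝ) ≤ P) (hP23 : M ^ (2 / 3 : ℝ) ≤ P)
    (hτ : 2 * (q.divisors.card : ℝ) + 7 ≤ 9 * J)
    (hEt : Real.sqrt B₀ * Real.sqrt E + B₀ / E ≤ 6 * M ^ (2 / 3 : ℝ)) :
    windowErr CV η n q 1 0 A' B₀ E ≤ (16 * Cρ + CV + 108) * J ^ 2 * Lg * P := by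
  have hJ0 : 0 ≤ J := by linarith
  have hP0 : 0 ≤ P := (Real.rpow_nonneg hM.le _).trans hP34
  have h1 : 4 * (rho n : ℝ) * (rhoSumAP B₀ q 1 0 : ℝ) / (A' : ℝ) ^ (1 / 4 : ℝ) ≤
      16 * Cρ * J * M ^ (3 / 4 : ℝ) :=
    firstTerm_le hM hρn (Nat.cast_nonneg _) hSum0 (Nat.cast_nonneg _) hCρ hA
  have h1' : 16 * Cρ * J * M ^ (3 / 4 : ℝ) ≤ 16 * Cρ * (J ^ 2 * Lg * P) := by
    rw [mul_assoc (16 * Cρ)]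
    apply mul_le_mul_of_nonneg_left _ (by positivity)
    calc J * M ^ (3 / 4 : ℝ) = (J * 1) * 1 * M ^ (3 / 4 : ℝ) := by ring
      _ ≤ (J * J) * Lg * P := by
          apply mul_le_mul _ hP34 (Real.rpow_nonneg hM.le _) (by positivity)
          exact mul_le_mul (mul_le_mul_of_nonneg_left hJ1 hJ0) hLg1 zero_le_one (by positivity)
      _ = J ^ 2 * Lg * P := by ring
  have h2 : CV * ((1 : ℕ) : ℝ) * (∑ l ∈ q.divisors, (rho (l * n) : ℝ)) * (1 + Real.log (16 * A')) ^ 2 *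
      ((Nat.sqrt (B₀ * n) : ℝ) ^ (1 / 2 + η) * Nat.sqrt (B₀ * n)) ≤ CV * (J ^ 2 * Lg * P) := by
    have hS0 : 0 ≤ (Nat.sqrt (B₀ * n) : ℝ) ^ (1 / 2 + η) * Nat.sqrt (B₀ * n) :=
      mul_nonneg (Real.rpow_nonneg (Nat.cast_nonneg _) _) (Nat.cast_nonneg _)
    calc CV * ((1 : ℕ) : ℝ) * (∑ l ∈ q.divisors, (rho (l * n) : ℝ)) * (1 + Real.log (16 * A')) ^ 2 *
          ((Nat.sqrt (B₀ * n) : ℝ) ^ (1 / 2 + η) * Nat.sqrt (B₀ * n))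
        = CV * ((∑ l ∈ q.divisors, (rho (l * n) : ℝ)) * ((1 + Real.log (16 * A')) ^ 2 *
          ((Nat.sqrt (B₀ * n) : ℝ) ^ (1 / 2 + η) * Nat.sqrt (B₀ * n)))) := by push_cast; ring
      _ ≤ CV * (J ^ 2 * (Lg * P)) := by
          apply mul_le_mul_of_nonneg_left _ hCV
          exact mul_le_mul hsum (mul_le_mul hlog hS hS0 (by positivity)) (by positivity)
            (by positivity)
      _ = CV * (J ^ 2 * Lg * P) := by ring
  have h3 : 2 / n * (rho n : ℝ) * ((2 * q.divisors.card + 7) * (Real.sqrt B₀ * Real.sqrt E + B₀ / E)) ≤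
      108 * (J ^ 2 * Lg * P) := by
    have hn0 : (1 : ℝ) ≤ n := by exact_mod_cast hn1
    have h2n : 2 / (n : ℝ) ≤ 2 := by
      rw [div_le_iff₀ (by positivity)]; nlinarith
    have hEt0 : 0 ≤ Real.sqrt B₀ * Real.sqrt E + B₀ / E := by positivity
    calc 2 / n * (rho n : ℝ) * ((2 * q.divisors.card + 7) * (Real.sqrt B₀ * Real.sqrt E + B₀ / E))
        ≤ 2 * J * (9 * J * (6 * M ^ (2 / 3 : ℝ))) :=
          mul_le_mul (mul_le_mul h2n hρn (Nat.cast_nonneg _) (by norm_num))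
            (mul_le_mul hτ hEt hEt0 (by positivity)) (by positivity) (by positivity)
      _ = 108 * ((J * J) * 1 * M ^ (2 / 3 : ℝ)) := by ring
      _ ≤ 108 * ((J * J) * Lg * P) := by
          apply mul_le_mul_of_nonneg_left _ (by norm_num)
          apply mul_le_mul _ hP23 (Real.rpow_nonneg hM.le _) (by positivity)
          exact mul_le_mul_of_nonneg_left hLg1 (by positivity)
      _ = 108 * (J ^ 2 * Lg * P) := by ring
  unfold windowErr
  simp only [Nat.div_one]
  have : (16 * Cρ + CV + 108) * J ^ 2 * Lg * P =
      16 * Cρ * (J ^ 2 * Lg * P) + CV * (J ^ 2 * Lg * P) + 108 * (J ^ 2 * Lg * P) := by ring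
  rw [this]
  exact add_le_add (add_le_add (h1.trans h1') h2) h3

/-! ### The crude bound for one pair -/

/-- `windowErr ≥ 0` for `C ≥ 0`. [folklore] -/
theorem windowErr_nonneg {C : ℝ} (hC : 0 ≤ C) (ε : ℝ) (q Q d μ A t E : ℕ) :
    0 ≤ windowErr C ε q Q d μ A t E := by
  unfold windowErr; positivity

/-- `∑_{l ∣ q} ρ(l k) ≤ J²` when `τ(q) ≤ J` and each `ρ(l k) ≤ J`. [folklore] -/
theorem sum_divisors_rho_le {q k : ℕ} {J : ℝ} (hJ0 : 0 ≤ J) (hτq : (q.divisors.card : ℝ) ≤ J)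
    (h : ∀ l ∈ q.divisors, (rho (l * k) : ℝ) ≤ J) :
    ∑ l ∈ q.divisors, (rho (l * k) : ℝ) ≤ J ^ 2 := by
  calc ∑ l ∈ q.divisors, (rho (l * k) : ℝ) ≤ ∑ l ∈ q.divisors, J := Finset.sum_le_sum h
    _ = q.divisors.card * J := by rw [Finset.sum_const, nsmul_eq_mul]
    _ ≤ J * J := mul_le_mul_of_nonneg_right hτq hJ0
    _ = J ^ 2 := (sq J).symm

/-- `Σ₀(B₀; q, 1, 0) ≤ C_ρ B₀` from the mean value of `ρ`. [folklore] -/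
theorem rhoSumAP_le_of_mean {Cρ : ℝ}
    (hSumRho : ∀ y : ℝ, 2 ≤ y → ∑ m ∈ Finset.Icc 1 ⌊y⌋₊, (rho m : ℝ) ≤ Cρ * y)
    {B₀ : ℕ} (hB : (2 : ℝ) ≤ B₀) (q : ℕ) : (rhoSumAP B₀ q 1 0 : ℝ) ≤ Cρ * B₀ := by
  have h1 : (rhoSumAP B₀ q 1 0 : ℝ) ≤ ∑ m ∈ Finset.Icc 1 B₀, (rho m : ℝ) := by
    unfold rhoSumAP
    push_cast
    rw [show Finset.Icc 1 B₀ = Finset.Ioc 0 B₀ from Finset.Icc_add_one_left_eq_Ioc 0 B₀]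
    exact Finset.sum_le_sum_of_subset_of_nonneg (Finset.filter_subset _ _)
      fun _ _ _ => Nat.cast_nonneg _
  have h2 := hSumRho (B₀ : ℝ) hB
  rw [Nat.floor_natCast] at h2
  exact h1.trans h2

set_option maxHeartbeats 1600000 in
/-- **The crude bound for the dispersion summand of one pair** (pp. 184–185): for `0 < η ≤ 1/2`
there is `C` such that for `2 ≤ M ≤ x`, squarefree `n₁, n₂ ∈ [1, K)`,
`|T(n₁,n₂)| ≤ C (K^{4η})³ (1 + log 16x)² (x (n₁,n₂)/(n₁n₂) + x² M^{−5/4+η/2} K^{3/2+η} (n₁,n₂))`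
(the `m`-range being `⌊M⌋ < m ≤ ⌈2M⌉ − 1`, i.e. `M < m < 2M`).
[cite: IwaniecInventiones1978, §4 pp. 184–185] -/
theorem abs_tsum2_le_crude (h6 : lemma6_hooley) {η : ℝ} (hη : 0 < η) (hη2 : η ≤ 1 / 2) :
    ∃ C : ℝ, 0 ≤ C ∧ ∀ (x M : ℝ) (K n₁ n₂ : ℕ), 2 ≤ M → M ≤ x →
      n₁ ∈ Finset.Ico 1 K → n₂ ∈ Finset.Ico 1 K → Squarefree n₁ → Squarefree n₂ →
      |tsum2 x (Finset.Ioc ⌊M⌋₊ (⌈2 * M⌉₊ - 1)) n₁ n₂| ≤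
        C * (((K : ℝ) ^ 4) ^ η) ^ 3 * (1 + Real.log (16 * x)) ^ 2 *
          (x * (Nat.gcd n₁ n₂ : ℝ) / ((n₁ : ℝ) * n₂) +
            x ^ 2 * M ^ (-(5 / 4 : ℝ) + η / 2) * (K : ℝ) ^ (3 / 2 + η : ℝ) * Nat.gcd n₁ n₂) := by
  obtain ⟨CV, CW, hCV0, hCW0, hPB⟩ := abs_tsum2_le h6 hη
  obtain ⟨Cτ, hCτ1, hτ⟩ := Literature.NumberTheory.Sieve.exists_card_divisors_le_mul_rpow hη
  obtain ⟨Cρ, hCρ0, hSumRho⟩ := exists_sum_rho_le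
  refine ⟨(8 * (16 * Cρ + CW + 108) + 8 * (16 * Cρ + CV + 108) + 140) * Cτ ^ 3,
    by positivity, ?_⟩
  intro x M K n₁ n₂ hM hMx hn₁ hn₂ hsf₁ hsf₂
  obtain ⟨hA2, hAB, hE1, hEA⟩ := params_nat hM
  obtain ⟨hAM, hMA, hAhalf, hB2M, hI2M, hEle, hEge, hB2⟩ := params_real hM
  have hM0 : 0 < M := by linarith
  have hM1 : 1 ≤ M := by linarith
  have hx0 : 0 ≤ x := by linarith
  rw [Finset.mem_Ico] at hn₁ hn₂
  have hK1 : 1 ≤ K := by omega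
  have hK1r : (1 : ℝ) ≤ K := by exact_mod_cast hK1
  have hn₁0 : n₁ ≠ 0 := by omega
  have hn₂0 : n₂ ≠ 0 := by omega
  have main := hPB x ⌊M⌋₊ (⌈2 * M⌉₊ - 1) ⌊M ^ (1 / 3 : ℝ)⌋₊ (Nat.sqrt (⌈2 * M⌉₊ - 1)) n₁ n₂ hx0
    hsf₁ hsf₂ hA2 hAB hE1 hEA le_rfl
  refine main.trans ?_
  clear main hPB
  unfold pairRes pairErr
  -- abbreviations
  set A' := ⌊M⌋₊ with hA'
  set B₀ := ⌈2 * M⌉₊ - 1 with hB₀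
  set E := ⌊M ^ (1 / 3 : ℝ)⌋₊ with hEdef
  set q := Nat.lcm n₁ n₂ with hq
  set d := Nat.gcd n₁ n₂ with hd
  set J : ℝ := Cτ * ((K : ℝ) ^ 4) ^ η with hJ
  set Lg : ℝ := (1 + Real.log (16 * x)) ^ 2 with hLg
  set P : ℝ := 2 * M ^ (3 / 4 + η / 2 : ℝ) * (K : ℝ) ^ (3 / 2 + η : ℝ) with hP
  set Z : ℝ := x ^ 2 * M ^ (-(5 / 4 : ℝ) + η / 2) * (K : ℝ) ^ (3 / 2 + η : ℝ) with hZ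
  set Kw : ℝ := 16 * Cρ + CW + 108 with hKw
  set Kv : ℝ := 16 * Cρ + CV + 108 with hKv
  clear_value A' B₀ E q d J Lg P Z Kw Kv
  have hKw0 : 0 ≤ Kw := by rw [hKw]; positivity
  have hKv0 : 0 ≤ Kv := by rw [hKv]; positivity
  -- `J` bounds
  have hK4 : (1 : ℝ) ≤ (K : ℝ) ^ 4 := one_le_pow₀ hK1r
  have hJ1 : 1 ≤ J := by
    rw [hJ]
    calc (1 : ℝ) = 1 * 1 := by ring
      _ ≤ Cτ * ((K : ℝ) ^ 4) ^ η :=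
          mul_le_mul hCτ1 (Real.one_le_rpow hK4 hη.le) zero_le_one (by linarith)
  have hJ0 : 0 ≤ J := by linarith
  have hJτ : ∀ k : ℕ, k ≠ 0 → (k : ℝ) ≤ (K : ℝ) ^ 4 → (k.divisors.card : ℝ) ≤ J := by
    intro k hk hkK
    rw [hJ]
    calc (k.divisors.card : ℝ) ≤ Cτ * (k : ℝ) ^ η := hτ k hk
      _ ≤ Cτ * ((K : ℝ) ^ 4) ^ η :=
          mul_le_mul_of_nonneg_left (Real.rpow_le_rpow (Nat.cast_nonneg _) hkK hη.le) (by linarith)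
  have hJρ : ∀ k : ℕ, k ≠ 0 → (k : ℝ) ≤ (K : ℝ) ^ 4 → (rho k : ℝ) ≤ J := by
    intro k hk hkK
    have : (rho k : ℝ) ≤ k.divisors.card := by exact_mod_cast rho_le_card_divisors k
    exact this.trans (hJτ k hk hkK)
  -- sizes of `n₁, n₂, q, d`
  have hn₁K : (n₁ : ℝ) ≤ K := by exact_mod_cast hn₁.2.le
  have hn₂K : (n₂ : ℝ) ≤ K := by exact_mod_cast hn₂.2.le
  have hKK2 : (K : ℝ) ≤ (K : ℝ) ^ 2 := le_self_pow₀ hK1r (by norm_num)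
  have hKK4 : (K : ℝ) ≤ (K : ℝ) ^ 4 := le_self_pow₀ hK1r (by norm_num)
  have hK2K4 : (K : ℝ) ^ 2 ≤ (K : ℝ) ^ 4 := pow_le_pow_right₀ hK1r (by norm_num)
  have hqle : q ≤ n₁ * n₂ := by
    rw [hq]; exact Nat.le_of_dvd (Nat.mul_pos (by omega) (by omega)) (Nat.lcm_dvd_mul n₁ n₂)
  have hqK2 : (q : ℝ) ≤ (K : ℝ) ^ 2 := by
    calc (q : ℝ) ≤ n₁ * n₂ := by exact_mod_cast hqle
      _ ≤ K * K := mul_le_mul hn₁K hn₂K (Nat.cast_nonneg _) (Nat.cast_nonneg _)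
      _ = (K : ℝ) ^ 2 := (sq _).symm
  have hq0 : q ≠ 0 := by rw [hq]; exact Nat.lcm_ne_zero hn₁0 hn₂0
  have hq1 : 1 ≤ q := Nat.pos_of_ne_zero hq0
  have hd1 : 1 ≤ d := by rw [hd]; exact Nat.gcd_pos_of_pos_left _ (by omega)
  have hdn₁ : d ≤ n₁ := by rw [hd]; exact Nat.gcd_le_left _ (by omega)
  have hdK : (d : ℝ) ≤ K := le_trans (by exact_mod_cast hdn₁) hn₁K
  have hd1r : (1 : ℝ) ≤ d := by exact_mod_cast hd1
  have hρ₁ : (rho n₁ : ℝ) ≤ J := hJρ n₁ hn₁0 (hn₁K.trans hKK4)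
  have hρ₂ : (rho n₂ : ℝ) ≤ J := hJρ n₂ hn₂0 (hn₂K.trans hKK4)
  have hρq : (rho q : ℝ) ≤ J := hJρ q hq0 (hqK2.trans hK2K4)
  have hτq : (q.divisors.card : ℝ) ≤ J := hJτ q hq0 (hqK2.trans hK2K4)
  have hτd : (d.divisors.card : ℝ) ≤ J := hJτ d (by omega) (hdK.trans hKK4)
  have hτ9 : 2 * (q.divisors.card : ℝ) + 7 ≤ 9 * J := by linarith
  have hsum : ∀ k : ℕ, k ≠ 0 → (k : ℝ) ≤ (K : ℝ) ^ 2 →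
      ∑ l ∈ q.divisors, (rho (l * k) : ℝ) ≤ J ^ 2 := by
    intro k hk hkK
    refine sum_divisors_rho_le hJ0 hτq fun l hl => hJρ _ ?_ ?_
    · exact Nat.mul_ne_zero (Nat.pos_of_mem_divisors hl).ne' hk
    · have hlq : (l : ℝ) ≤ q := by exact_mod_cast Nat.divisor_le hl
      calc ((l * k : ℕ) : ℝ) = l * k := by push_cast; ring
        _ ≤ (K : ℝ) ^ 2 * (K : ℝ) ^ 2 :=
            mul_le_mul (hlq.trans hqK2) hkK (Nat.cast_nonneg _) (by positivity)
        _ = (K : ℝ) ^ 4 := by ring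
  -- the other ingredients
  have hSig : (rhoSumAP B₀ q 1 0 : ℝ) ≤ 2 * Cρ * M := by
    calc (rhoSumAP B₀ q 1 0 : ℝ) ≤ Cρ * B₀ := rhoSumAP_le_of_mean hSumRho hB2 q
      _ ≤ Cρ * (2 * M) := mul_le_mul_of_nonneg_left hB2M hCρ0.le
      _ = 2 * Cρ * M := by ring
  have hA4 : M ^ (1 / 4 : ℝ) / 2 ≤ (A' : ℝ) ^ (1 / 4 : ℝ) := quarter_le hM0.le hAhalf
  have hLg1 : 1 ≤ 1 + Real.log (16 * x) := by
    have : 0 ≤ Real.log (16 * x) := Real.log_nonneg (by linarith)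
    linarith
  have hLgsq1 : 1 ≤ Lg := by rw [hLg]; exact one_le_pow₀ hLg1
  have hLgle : 1 + Real.log (16 * x) ≤ Lg := by rw [hLg]; exact le_self_pow₀ hLg1 (by norm_num)
  have hA0 : (0 : ℝ) < A' := by
    have : (2 : ℝ) ≤ A' := by exact_mod_cast hA2
    linarith
  have hlogA : (1 + Real.log (16 * A')) ^ 2 ≤ Lg := by
    rw [hLg]
    have h1 : Real.log (16 * A') ≤ Real.log (16 * x) :=
      Real.log_le_log (by positivity) (by linarith)
    have h0 : 0 ≤ 1 + Real.log (16 * A') := by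
      have : 0 ≤ Real.log (16 * A') := Real.log_nonneg (by linarith)
      linarith
    exact pow_le_pow_left₀ h0 (by linarith) 2
  have hEt : Real.sqrt B₀ * Real.sqrt E + B₀ / E ≤ 6 * M ^ (2 / 3 : ℝ) :=
    eterm_le hM1 hB2M hEle hEge hE1
  have hKpow1 : (1 : ℝ) ≤ (K : ℝ) ^ (3 / 2 + η : ℝ) := Real.one_le_rpow hK1r (by linarith)
  have hM34 : 0 ≤ M ^ (3 / 4 + η / 2 : ℝ) := Real.rpow_nonneg hM0.le _
  have hP2 : M ^ (3 / 4 + η / 2 : ℝ) ≤ P / 2 := by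
    calc M ^ (3 / 4 + η / 2 : ℝ) = M ^ (3 / 4 + η / 2 : ℝ) * 1 := (mul_one _).symm
      _ ≤ M ^ (3 / 4 + η / 2 : ℝ) * (K : ℝ) ^ (3 / 2 + η : ℝ) :=
          mul_le_mul_of_nonneg_left hKpow1 hM34
      _ = P / 2 := by rw [hP]; ring
  have hPhalf : P / 2 ≤ P := by
    have : 0 ≤ P := by rw [hP]; positivity
    linarith
  have hP34 : M ^ (3 / 4 : ℝ) ≤ P := by
    have h1 : M ^ (3 / 4 : ℝ) ≤ M ^ (3 / 4 + η / 2 : ℝ) :=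
      Real.rpow_le_rpow_of_exponent_le hM1 (by linarith)
    exact h1.trans (hP2.trans hPhalf)
  have hM23le : M ^ (2 / 3 : ℝ) ≤ M ^ (3 / 4 + η / 2 : ℝ) :=
    Real.rpow_le_rpow_of_exponent_le hM1 (by linarith)
  have hP23 : M ^ (2 / 3 : ℝ) ≤ P :=
    (Real.rpow_le_rpow_of_exponent_le hM1 (by norm_num : (2 / 3 : ℝ) ≤ 3 / 4)).trans hP34
  have hP0 : 0 ≤ P := by rw [hP]; positivity
  have hS : ∀ k : ℕ, (k : ℝ) ≤ (K : ℝ) ^ 2 →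
      (Nat.sqrt (B₀ * k) : ℝ) ^ (1 / 2 + η) * Nat.sqrt (B₀ * k) ≤ P := by
    intro k hk; rw [hP]; exact sfac_le hM1 hK1r hη.le hη2 hB2M hk
  -- the two crude Lemma-4 errors
  have hwErr : wErr CW η q d A' B₀ E ≤ Kw * d * J ^ 2 * Lg * P := by
    rw [hKw]
    exact wErr_le_crude hCW0 hCρ0.le hJ1 hM0 hLgsq1 hq1 hd1 hρq hSig hA4 (hsum q hq0 hqK2) hlogA
      (hS q hqK2) hP34 hP23 hτ9 hEt
  have hwin₁ : windowErr CV η n₁ q 1 0 A' B₀ E ≤ Kv * J ^ 2 * Lg * P := by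
    rw [hKv]
    exact windowErr_le_crude hCV0 hCρ0.le hJ1 hM0 hLgsq1 hn₁.1 hρ₁ hSig hA4
      (hsum n₁ hn₁0 (hn₁K.trans hKK2)) hlogA (hS n₁ (hn₁K.trans hKK2)) hP34 hP23 hτ9 hEt
  have hwin₂ : windowErr CV η n₂ q 1 0 A' B₀ E ≤ Kv * J ^ 2 * Lg * P := by
    rw [hKv]
    exact windowErr_le_crude hCV0 hCρ0.le hJ1 hM0 hLgsq1 hn₂.1 hρ₂ hSig hA4
      (hsum n₂ hn₂0 (hn₂K.trans hKK2)) hlogA (hS n₂ (hn₂K.trans hKK2)) hP34 hP23 hτ9 hEt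
  -- the geometric factors
  have hLfac : (((⌊x⌋₊ / (A' + 1) + 1 : ℕ)) : ℝ) ≤ 2 * x / M := lfac_le hM0 hMx hMA
  have hLfac0 : 0 ≤ (((⌊x⌋₊ / (A' + 1) + 1 : ℕ)) : ℝ) := Nat.cast_nonneg _
  have hPM : x ^ 2 * P / M ^ 2 = 2 * Z := by
    rw [hP, hZ]
    have : M ^ (-(5 / 4 : ℝ) + η / 2) = M ^ (3 / 4 + η / 2 : ℝ) / M ^ 2 := by
      rw [← Real.rpow_two, ← Real.rpow_sub hM0]; congr 1; ring
    rw [this]; field_simp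
  have hZ0 : 0 ≤ Z := by rw [hZ]; positivity
  have hA1M : M ≤ (A' : ℝ) + 1 := hMA.le
  have hn₁0' : (0 : ℝ) < n₁ := by exact_mod_cast hn₁.1
  have hn₂0' : (0 : ℝ) < n₂ := by exact_mod_cast hn₂.1
  have he₁ : (rho n₁ : ℝ) / n₁ ≤ J :=
    (div_le_self (Nat.cast_nonneg _) (by exact_mod_cast hn₁.1)).trans hρ₁
  have he₂ : (rho n₂ : ℝ) / n₂ ≤ J :=
    (div_le_self (Nat.cast_nonneg _) (by exact_mod_cast hn₂.1)).trans hρ₂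
  have he₁0 : 0 ≤ (rho n₁ : ℝ) / n₁ := by positivity
  have he₂0 : 0 ≤ (rho n₂ : ℝ) / n₂ := by positivity
  -- (a) the residual
  have hκ : |kappa q (Nat.sqrt B₀) E| ≤ 2 * (1 + Real.log (16 * x)) := by
    refine (abs_kappa_le_log q _ E).trans ?_
    have hE0 : (0 : ℝ) < E := by exact_mod_cast hE1
    have hEx : (E : ℝ) ≤ 16 * x := by
      calc (E : ℝ) ≤ M ^ (1 / 3 : ℝ) := hEle
        _ ≤ M ^ (1 : ℝ) := Real.rpow_le_rpow_of_exponent_le hM1 (by norm_num)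
        _ = M := Real.rpow_one M
        _ ≤ 16 * x := by linarith
    have := Real.log_le_log hE0 hEx
    linarith
  have hResSum : ∑ m ∈ Finset.Ioc A' B₀,
      (((d : ℝ) + 2) * (((⌊x⌋₊ / m : ℕ) : ℝ) + 1) + 2 * (x / m)) ≤ 16 * d * x := by
    have hper : ∀ m ∈ Finset.Ioc A' B₀,
        ((d : ℝ) + 2) * (((⌊x⌋₊ / m : ℕ) : ℝ) + 1) + 2 * (x / m) ≤ 8 * d * (x / M) := by
      intro m hm
      rw [Finset.mem_Ioc] at hm
      have hm0 : 0 < m := by omega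
      have hmM : M ≤ m := by
        have : (A' : ℝ) + 1 ≤ m := by exact_mod_cast hm.1
        linarith
      have hxm : x / m ≤ x / M := div_le_div_of_nonneg_left hx0 hM0 hmM
      have hL : (((⌊x⌋₊ / m : ℕ) : ℝ)) ≤ x / m := by linarith [(natFloor_div_sub hx0 hm0).1]
      have hxM1 : 1 ≤ x / M := by rw [le_div_iff₀ hM0]; linarith
      have hd2 : (d : ℝ) + 2 ≤ 3 * d := by linarith
      have hxM0 : 0 ≤ x / M := by positivity
      calc ((d : ℝ) + 2) * (((⌊x⌋₊ / m : ℕ) : ℝ) + 1) + 2 * (x / m)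
          ≤ (3 * d) * (2 * (x / M)) + 2 * (x / M) := by
            apply add_le_add _ (by linarith)
            exact mul_le_mul hd2 (by linarith) (by positivity) (by positivity)
        _ = (6 * d + 2) * (x / M) := by ring
        _ ≤ 8 * d * (x / M) := mul_le_mul_of_nonneg_right (by linarith) hxM0
    calc _ ≤ ∑ m ∈ Finset.Ioc A' B₀, 8 * (d : ℝ) * (x / M) := Finset.sum_le_sum hper
      _ = ((B₀ - A' : ℕ) : ℝ) * (8 * d * (x / M)) := by
          rw [Finset.sum_const, Nat.card_Ioc, nsmul_eq_mul]
      _ ≤ 2 * M * (8 * d * (x / M)) := mul_le_mul_of_nonneg_right hI2M (by positivity)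
      _ = 16 * d * x := by field_simp; ring
  have hRes : |kappa q (Nat.sqrt B₀) E| * ((rho n₁ : ℝ) / n₁ * ((rho n₂ : ℝ) / n₂) *
      ∑ m ∈ Finset.Ioc A' B₀, (((d : ℝ) + 2) * (((⌊x⌋₊ / m : ℕ) : ℝ) + 1) + 2 * (x / m))) ≤
      32 * J ^ 3 * Lg * (x * d / (n₁ * n₂)) := by
    have hsum0 : 0 ≤ ∑ m ∈ Finset.Ioc A' B₀,
        (((d : ℝ) + 2) * (((⌊x⌋₊ / m : ℕ) : ℝ) + 1) + 2 * (x / m)) :=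
      Finset.sum_nonneg fun m _ => by positivity
    have h1 : (rho n₁ : ℝ) / n₁ * ((rho n₂ : ℝ) / n₂) ≤ J / n₁ * (J / n₂) :=
      mul_le_mul (div_le_div_of_nonneg_right hρ₁ hn₁0'.le)
        (div_le_div_of_nonneg_right hρ₂ hn₂0'.le) he₂0 (by positivity)
    calc _ ≤ (2 * (1 + Real.log (16 * x))) * ((J / n₁ * (J / n₂)) * (16 * d * x)) :=
          mul_le_mul hκ (mul_le_mul h1 hResSum hsum0 (by positivity)) (by positivity)
            (by positivity)
      _ = 32 * (J ^ 2 * 1) * (1 + Real.log (16 * x)) * (x * d / (n₁ * n₂)) := by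
          field_simp; ring
      _ ≤ 32 * (J ^ 2 * J) * Lg * (x * d / (n₁ * n₂)) := by
          apply mul_le_mul _ le_rfl (by positivity) (by positivity)
          apply mul_le_mul _ hLgle (by positivity) (by positivity)
          exact mul_le_mul_of_nonneg_left (mul_le_mul_of_nonneg_left hJ1 (by positivity))
            (by norm_num)
      _ = 32 * J ^ 3 * Lg * (x * d / (n₁ * n₂)) := by ring
  -- (b) the four error terms
  have hEW : (((⌊x⌋₊ / (A' + 1) + 1 : ℕ)) : ℝ) ^ 2 *
      ((d.divisors.card : ℝ) * wErr CW η q d A' B₀ E) ≤ 8 * Kw * d * J ^ 3 * Lg * Z := by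
    have hw0 : 0 ≤ wErr CW η q d A' B₀ E := wErr_nonneg hCW0 η q d A' B₀ E
    calc _ ≤ (2 * x / M) ^ 2 * (J * (Kw * d * J ^ 2 * Lg * P)) :=
          mul_le_mul (pow_le_pow_left₀ hLfac0 hLfac 2) (mul_le_mul hτd hwErr hw0 hJ0)
            (by positivity) (by positivity)
      _ = 4 * Kw * d * J ^ 3 * Lg * (x ^ 2 * P / M ^ 2) := by field_simp; ring
      _ = 8 * Kw * d * J ^ 3 * Lg * Z := by rw [hPM]; ring
  have hEV : ∀ (e win : ℝ), 0 ≤ e → e ≤ J → 0 ≤ win → win ≤ Kv * J ^ 2 * Lg * P →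
      x * e * ((((⌊x⌋₊ / (A' + 1) + 1 : ℕ)) : ℝ) * win / (A' + 1)) ≤ 4 * Kv * J ^ 3 * Lg * Z := by
    intro e win he0 heJ hw0 hwle
    have h1 : win / ((A' : ℝ) + 1) ≤ (Kv * J ^ 2 * Lg * P) / M :=
      div_le_div₀ (by positivity) hwle hM0 hA1M
    calc x * e * ((((⌊x⌋₊ / (A' + 1) + 1 : ℕ)) : ℝ) * win / (A' + 1))
        = x * e * ((((⌊x⌋₊ / (A' + 1) + 1 : ℕ)) : ℝ) * (win / (A' + 1))) := by ring
      _ ≤ x * J * ((2 * x / M) * ((Kv * J ^ 2 * Lg * P) / M)) :=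
          mul_le_mul (mul_le_mul_of_nonneg_left heJ hx0)
            (mul_le_mul hLfac h1 (by positivity) (by positivity)) (by positivity) (by positivity)
      _ = 2 * Kv * J ^ 3 * Lg * (x ^ 2 * P / M ^ 2) := by field_simp
      _ = 4 * Kv * J ^ 3 * Lg * Z := by rw [hPM]; ring
  have hEV₁ := hEV ((rho n₂ : ℝ) / n₂) (windowErr CV η n₁ q 1 0 A' B₀ E) he₂0 he₂
    (windowErr_nonneg hCV0 η n₁ q 1 0 A' B₀ E) hwin₁
  have hEV₂ := hEV ((rho n₁ : ℝ) / n₁) (windowErr CV η n₂ q 1 0 A' B₀ E) he₁0 he₁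
    (windowErr_nonneg hCV0 η n₂ q 1 0 A' B₀ E) hwin₂
  have hEU : x ^ 2 * ((rho n₁ : ℝ) / n₁) * ((rho n₂ : ℝ) / n₂) *
      (2 * ((2 * (q.divisors.card : ℝ) + 7) * (Real.sqrt B₀ * Real.sqrt E + B₀ / E)) /
        ((A' : ℝ) + 1) ^ 2) ≤ 108 * J ^ 3 * Lg * Z := by
    have hEt0 : 0 ≤ Real.sqrt B₀ * Real.sqrt E + B₀ / E := by positivity
    have h1 : 2 * ((2 * (q.divisors.card : ℝ) + 7) * (Real.sqrt B₀ * Real.sqrt E + B₀ / E)) /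
        ((A' : ℝ) + 1) ^ 2 ≤ 2 * (9 * J * (6 * M ^ (2 / 3 : ℝ))) / M ^ 2 :=
      div_le_div₀ (by positivity)
        (mul_le_mul_of_nonneg_left (mul_le_mul hτ9 hEt hEt0 (by positivity)) (by norm_num))
        (by positivity) (pow_le_pow_left₀ hM0.le hA1M 2)
    have h2 : M ^ (2 / 3 : ℝ) ≤ P / 2 := hM23le.trans hP2
    have h3 : 2 * (9 * J * (6 * M ^ (2 / 3 : ℝ))) / M ^ 2 ≤ 2 * (9 * J * (6 * (P / 2))) / M ^ 2 := by
      apply div_le_div_of_nonneg_right _ (by positivity)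
      apply mul_le_mul_of_nonneg_left _ (by norm_num)
      exact mul_le_mul_of_nonneg_left (mul_le_mul_of_nonneg_left h2 (by norm_num)) (by positivity)
    calc _ ≤ x ^ 2 * J * J * (2 * (9 * J * (6 * (P / 2))) / M ^ 2) :=
          mul_le_mul (mul_le_mul (mul_le_mul_of_nonneg_left he₁ (by positivity)) he₂ he₂0
            (by positivity)) (h1.trans h3) (by positivity) (by positivity)
      _ = 54 * J ^ 3 * (x ^ 2 * P / M ^ 2) := by field_simp; ring
      _ = 108 * (J ^ 3 * Z) := by rw [hPM]; ring
      _ ≤ 108 * (J ^ 3 * Lg * Z) := by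
          apply mul_le_mul_of_nonneg_left _ (by norm_num)
          rw [mul_assoc]
          exact mul_le_mul_of_nonneg_left (le_mul_of_one_le_left hZ0 hLgsq1) (by positivity)
      _ = 108 * J ^ 3 * Lg * Z := by ring
  -- (c) combine
  set U₁ : ℝ := J ^ 3 * Lg * (x * d / (n₁ * n₂)) with hU₁
  set U₂ : ℝ := J ^ 3 * Lg * Z with hU₂
  have hU₁0 : 0 ≤ U₁ := by rw [hU₁]; positivity
  have hU₂0 : 0 ≤ U₂ := by rw [hU₂]; positivity
  have hU₂d : U₂ ≤ U₂ * d := le_mul_of_one_le_right hU₂0 hd1r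
  have hKvU : Kv * U₂ ≤ Kv * (U₂ * d) := mul_le_mul_of_nonneg_left hU₂d hKv0
  have hKwU1 : 0 ≤ Kw * U₁ := mul_nonneg hKw0 hU₁0
  have hKvU1 : 0 ≤ Kv * U₁ := mul_nonneg hKv0 hU₁0
  have hLHS := add_le_add hRes (add_le_add (add_le_add (add_le_add hEW hEV₁) hEV₂) hEU)
  have hmid : 32 * J ^ 3 * Lg * (x * d / (n₁ * n₂)) +
      (8 * Kw * d * J ^ 3 * Lg * Z + 4 * Kv * J ^ 3 * Lg * Z + 4 * Kv * J ^ 3 * Lg * Z +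
        108 * J ^ 3 * Lg * Z) =
      32 * U₁ + 8 * (Kw * (U₂ * d)) + 8 * (Kv * U₂) + 108 * U₂ := by
    rw [hU₁, hU₂]; ring
  have hexp : (8 * Kw + 8 * Kv + 140) * Cτ ^ 3 * (((K : ℝ) ^ 4) ^ η) ^ 3 * Lg *
      (x * d / (n₁ * n₂) + Z * d) =
      8 * (Kw * U₁) + 8 * (Kv * U₁) + 140 * U₁ + 8 * (Kw * (U₂ * d)) + 8 * (Kv * (U₂ * d)) +
        140 * (U₂ * d) := by
    rw [hU₁, hU₂, hJ]; ring
  rw [hmid] at hLHS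
  rw [hexp]
  linarith

end Literature.NumberTheory.Sieve.Iwaniec1978

end
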